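import Summits.Ventures.PercRepro.RankLevelSetExplicitLin2KeyL

/-!
# PercRepro — THE LEVEL-12 THEOREM-M ROW OF C-025 OVER THE 5/8 RANGE: THE KEY AT `p = 2 769` (p9, S4; the key is p4's)

`proofs/SUBCLAIM-S4-p9.md` §S4.2⁗⁗. p4's THEOREM-M key `KeyL 12 p d` (RankLevelSetExplicitLin2KeyL) checked by the kernel at
`p = 2 769` on the coranks `13 ≤ d ≤ 2572` of THE 5/8 RANGE (`D' = 12 + 5·2^{9} = 2572`; the large-corank theorem
`c025_core_explicit_large_of58` takes the coranks beyond): `2 769` = the least `p` with the optimal Chernoff pair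
`16·n^n ≤ 2^n·(n − K)^{n−K}·K^K` at `n = p + D'`, `K = 12 + D'` (twin lean-drafts/p9/g7/twin/range58.py), at or above the key's
own floor and the bases `N₁ = 2 691`, `P₂ = 2 598` (RankLevelSetExplicitLin2Bases58); p4's sharp row sits at `4 349`
(RankLevelSetExplicitLin2IndepFloorS). The level step and the unconditional chain are RankLevelSetExplicitLin2IndepFloor58.
Axioms: standard (kernel `decide`).
-/

namespace PercRepro

namespace ThmN

namespace Explicit

/-- The THEOREM-M key row at `(q, p) = (12, 2 769)`, chunk 1 of 2: coranks `13 … 2060`, by the kernel. -/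
theorem key_twelve_indep58_row_1 : ∀ t < 2048, KeyL 12 2769 (13 + t) := by decide +kernel

/-- The THEOREM-M key row at `(q, p) = (12, 2 769)`, chunk 2 of 2: coranks `2061 … 2572`, by the kernel. -/
theorem key_twelve_indep58_row_2 : ∀ t < 512, KeyL 12 2769 (13 + (2048 + t)) := by decide +kernel

/-- **THE THEOREM-M KEY ROW AT `(q, p) = (12, 2 769)` OVER THE 5/8 RANGE**: `KeyL 12 2769 d` at every corank `13 ≤ d ≤ 2572` (the 2 chunks). -/
theorem key_twelve_indep58_row : ∀ t < 2560, KeyL 12 2769 (13 + t) :=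
  ball_lt_add (fun t => KeyL 12 2769 (13 + t)) 2048 512
    key_twelve_indep58_row_1 key_twelve_indep58_row_2

end Explicit

end ThmN

end PercRepro
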